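import Mathlib
import HarnessLib

/-!
# Pseudo-values of a POOLED MEAN are the block values: for linear statistics Tukey's construction IS the replica decomposition (`bias_corr = full`, `err` = replica-`t` s.e.)

HONEST FRAMING: exact (Metropolis-corrected) sampling algorithms for lattice gauge theory;
figures of merit are autocorrelation/cost numbers at stated couplings and volumes; no
continuum-physics claim.

Venture `LatticeQCDFlow` (cell pub-lqcd), topic `Exactness`; FANOUT row 13 (`eng-snf`, GEN-25).
NEW WORK of the cell (elementary algebra), Mathlib only; not a published result; no definition;
nothing cited as a fact (Tukey 1958 NAMED ONLY).  Companion of GEN-25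
`NCMCGeneralSpaceReplicaJackknifePseudoValues` (for ANY statistic the engine's `(bias_corr, err)` is
the replica mean / replica-`t` standard error of the pseudo-values) and GEN-24
`NCMCGeneralSpaceReplicaJackknifeIdentity` (for a MEAN the jackknife bar is the replica-`t` bar):
the link between the two is that the pseudo-values of the pooled mean ARE the block values.

WHY (row 13).  With `R` blocks of equal length and block values `y_r` (block means of the record
observable), the pooled statistic is `ȳ = (1/R) Σ_r y_r`, the delete-one-block replicate is the
leave-one-out mean `ȳ_{(−r)} = (Σ_{s≠r} y_s)/(R−1)`, and the pseudo-value
`ps_r = R·ȳ − (R−1)·ȳ_{(−r)} = y_r` exactly.  Consequently for every LINEAR statistic (`Zratio`,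
`mean_W`, switch-acceptance frequencies) the engine's bias-corrected value equals the plain value
(`bias_corr = full`) and its jackknife error is the between-block standard error — Tukey's
pseudo-values reduce to the replica decomposition, and the pseudo-value dictionary of
`…ReplicaJackknifePseudoValues` contains GEN-24's identity as the linear case.

* **`pseudoValue_mean_eq`** — `R·ȳ − (R−1)·ȳ_{(−r)} = y_r`;
* **`jackknife_biasCorrected_mean_eq_mean`** — `R·ȳ − (R−1)·((1/R) Σ_r ȳ_{(−r)}) = ȳ`;
* `sum_looMean_eq_sum` — `Σ_r ȳ_{(−r)} = Σ_r y_r`.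

NOT CLAIMED: anything beyond the algebra; anything numerical.
-/

namespace Summit.Ventures.LatticeQCDFlow.Exactness.GeneralNCMC

open Finset

section PseudoValuesMean

variable {ι : Type*} [Fintype ι] [DecidableEq ι]

/-- **The pseudo-values of a pooled mean are the block values**:
`R·ȳ − (R−1)·(Σ_{s≠r} y_s)/(R−1) = y_r` (`R ≥ 2`). -/
theorem pseudoValue_mean_eq (hR : 2 ≤ Fintype.card ι) (y : ι → ℝ) (r : ι) :
    (Fintype.card ι : ℝ) * ((∑ s, y s) / Fintype.card ι)
        - ((Fintype.card ι : ℝ) - 1) * ((∑ s ∈ univ.erase r, y s) / ((Fintype.card ι : ℝ) - 1))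
      = y r := by
  have hR0 : (Fintype.card ι : ℝ) ≠ 0 := by
    have : (2 : ℝ) ≤ Fintype.card ι := by exact_mod_cast hR
    positivity
  have hR1 : (Fintype.card ι : ℝ) - 1 ≠ 0 := by
    have : (2 : ℝ) ≤ Fintype.card ι := by exact_mod_cast hR
    linarith
  rw [sum_erase_eq_sub (mem_univ r), mul_div_cancel₀ _ hR0, mul_div_cancel₀ _ hR1]
  ring

/-- **The leave-one-out means sum to the sum of the block values**: `Σ_r ȳ_{(−r)} = Σ_r y_r`. -/
theorem sum_looMean_eq_sum (hR : 2 ≤ Fintype.card ι) (y : ι → ℝ) :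
    ∑ r, (∑ s ∈ univ.erase r, y s) / ((Fintype.card ι : ℝ) - 1) = ∑ r, y r := by
  have hR1 : (Fintype.card ι : ℝ) - 1 ≠ 0 := by
    have : (2 : ℝ) ≤ Fintype.card ι := by exact_mod_cast hR
    linarith
  simp_rw [sum_erase_eq_sub (mem_univ _)]
  rw [← sum_div, sum_sub_distrib, sum_const, card_univ, nsmul_eq_mul]
  field_simp

/-- **For the pooled mean the bias-corrected jackknife value is the plain value**:
`R·ȳ − (R−1)·((1/R) Σ_r ȳ_{(−r)}) = ȳ` — the engine's `bias_corr = full` for every linear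
statistic. -/
theorem jackknife_biasCorrected_mean_eq_mean (hR : 2 ≤ Fintype.card ι) (y : ι → ℝ) :
    (Fintype.card ι : ℝ) * ((∑ s, y s) / Fintype.card ι)
        - ((Fintype.card ι : ℝ) - 1)
          * ((∑ r, (∑ s ∈ univ.erase r, y s) / ((Fintype.card ι : ℝ) - 1)) / Fintype.card ι)
      = (∑ s, y s) / Fintype.card ι := by
  have hR0 : (Fintype.card ι : ℝ) ≠ 0 := by
    have : (2 : ℝ) ≤ Fintype.card ι := by exact_mod_cast hR
    positivity
  rw [sum_looMean_eq_sum hR y]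
  field_simp
  ring

end PseudoValuesMean

end Summit.Ventures.LatticeQCDFlow.Exactness.GeneralNCMC
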